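import Summits.HubbardSuperconductivity.HubbardSuperconductivity.Theorems.AnisotropyChordThermalCondensateDefs
import Summits.HubbardSuperconductivity.HubbardSuperconductivity.Theorems.AnisotropyChordChordToOrderXY

/-!
# Route `AnisotropyChord`, crux `ChordXY` (stmt-HubbardSuperconductivity-8146), line `thermal_af`:
# the canonical sector condensate `Λ_{β,M}(Δ)` — POSITIVITY, the registered stub `stub_thermalChordAF`
# at its ENDPOINTS `Δ ∈ {-1, 0}` and at `β = 0`, and the CONVERSE TRANSFER (strict ground-state chord ⇒
# thermal chord)

Notation (defs of `…Theorems.AnisotropyChordThermalCondensateDefs`, verbatim the registered skeleton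
`c9438cf6…`): `P₀ = sectorProj M` (orthogonal projection onto the half-filled sector `S^z_tot = 0`),
`A = condensateOp M = S⁺_tot S⁻_tot`, `H_M(Δ) = xxzHamiltonian 1 (torusGraph 2 M) (-1) Δ`,
`Λ_{β,M}(Δ) = thermalCondensate M β Δ = Re( tr(P₀ e^{-βH_M(Δ)} A) / tr(P₀ e^{-βH_M(Δ)}) )`.

The registered stub `stub_thermalChordAF` asks, for every even `M ≥ 4` and `Δ ∈ [-1,0]`, that
`(1+Δ)·Λ_{β,M}(0) ≤ Λ_{β,M}(Δ)` eventually in `β`. This file lands the parts of it that hold for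
structural reasons, and the abstract positivity facts every attack on it uses:

* `trace_proj_gibbsWeight_mul_eq` — for a Hermitian idempotent `P` commuting with a Hermitian `H`,
  `tr(P e^{-βH} X) = tr((PV) X (PV)ᴴ)` with `V = e^{-(β/2)H}` and `PV` Hermitian; hence
  `re_trace_proj_gibbsWeight_mul_nonneg` (`tr(P e^{-βH} X) ≥ 0` for `X ≥ 0`),
  `trace_proj_gibbsWeight_pos` (`tr(P e^{-βH}) > 0` for `P ≠ 0`): the SECTOR PARTITION FUNCTION is
  positive and sector Gibbs averages of positive observables are nonnegative;
* `condensateOp_posSemidef` (`S⁺_tot S⁻_tot = B Bᴴ ≥ 0`), `sectorProj_commute_xxz`,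
  `sectorPartition_pos` (`tr(P₀ e^{-βH_M(Δ)}) > 0`, even `M ≥ 2`, every real `β, Δ`),
  **`thermalCondensate_nonneg`** (`Λ_{β,M}(Δ) ≥ 0`, every `M, β, Δ`);
* **`stub_thermalChordAF_endpoints`** — the stub's inequality at `Δ = -1` (it reads `0 ≤ Λ_{β,M}(-1)`)
  and at `Δ = 0` (an identity), for EVERY `β` (hence eventually);
* `thermalCondensate_beta_zero`, **`thermalChordAF_beta_zero`** — at infinite temperature `Λ_{0,M}` does
  not depend on `Δ`, so the chord holds at `β = 0` for every `Δ ≤ 0` (the skeleton card's remark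
  "at small β it holds trivially", made exact at `β = 0`);
* **`eventually_thermalChord_lt_of_groundChord_lt`**, **`stub_thermalChordAF_of_strictGroundChord`** —
  the CONVERSE of the skeleton's composition `chordXY_of_thermal`: wherever the ground-state chord
  `(1+Δ)Λ(ψ₀) < Λ(ψ)` is STRICT, the thermal chord holds eventually in `β` (both sides converge by the
  landed `stub_groundStateLimit`); so at a fixed even `M ≥ 4` the registered stub FOLLOWS from the strict
  ground-state chord on the open interval `(-1,0)` — the thermal detour is not a weakening of the crux
  away from the endpoints, and a finite-`M` certificate of the strict chord discharges the stub at that `M`.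

Nothing here proves the thermal chord on `(-1,0)` (the open engine statement); no crux closes.
Sources: O. Bratteli, D. W. Robinson, *Operator Algebras and Quantum Statistical Mechanics II* §5.3.1
(positivity of Gibbs functionals); H. Tasaki, *Physics and Mathematics of Quantum Many-Body Systems*
(2020) §2.2, App. A.2 (sectors, projections). Folklore linear algebra; no definition is introduced.
-/

set_option linter.dupNamespace false

noncomputable section

open scoped Matrix.Norms.L2Operator ComplexOrder

namespace Summit.HubbardSuperconductivity.HubbardSuperconductivity.Theorems.AnisotropyChord

open Matrix Filter Topology
open Literature.MathematicalPhysics.QuantumLattice Literature.Probability.LatticeModels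

/-! ### Abstract positivity of projected Gibbs traces -/

section Abstract

variable {n : Type*} [Fintype n] [DecidableEq n]

/-- Semigroup law at half inverse temperature: `e^{-(β/2)H} e^{-(β/2)H} = e^{-βH}`.
Bratteli–Robinson II §5.3.1. [folklore] -/
theorem gibbsWeight_half_mul_half (β : ℝ) (H : Matrix n n ℂ) :
    gibbsWeight (β / 2) H * gibbsWeight (β / 2) H = gibbsWeight β H := by
  unfold gibbsWeight
  rw [← Matrix.exp_add_of_commute _ _ (Commute.refl _), ← add_smul]
  congr 1
  push_cast
  ring

/-- A matrix commuting with `H` commutes with every Gibbs weight `e^{-βH}` (`Commute.exp_right`).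
Bratteli–Robinson II §5.3.1. [folklore] -/
theorem commute_gibbsWeight_of_commute {P H : Matrix n n ℂ} (hPH : Commute P H) (β : ℝ) :
    Commute P (gibbsWeight β H) :=
  (hPH.smul_right (-(β : ℂ))).exp_right

/-- For a Hermitian idempotent `P` commuting with a Hermitian `H`, `P e^{-(β/2)H}` is Hermitian.
[folklore] -/
theorem conjTranspose_proj_mul_gibbsWeight {P H : Matrix n n ℂ} (hP : P.IsHermitian)
    (hH : H.IsHermitian) (hPH : Commute P H) (β : ℝ) :
    (P * gibbsWeight β H)ᴴ = P * gibbsWeight β H := by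
  rw [conjTranspose_mul, (isHermitian_gibbsWeight β hH).eq, hP.eq,
    (commute_gibbsWeight_of_commute hPH β).eq]

/-- **Projected Gibbs traces are compressions.** For a Hermitian idempotent `P` commuting with a
Hermitian `H` and any `X`: `tr(P e^{-βH} X) = tr((PV) X (PV)ᴴ)` with `V = e^{-(β/2)H}`
(`P e^{-βH} = P V P V = (PV)(PV)ᴴ` and cyclicity). Bratteli–Robinson II §5.3.1. [folklore] -/
theorem trace_proj_gibbsWeight_mul_eq {P H : Matrix n n ℂ} (hP : P.IsHermitian) (hPP : P * P = P)
    (hH : H.IsHermitian) (hPH : Commute P H) (β : ℝ) (X : Matrix n n ℂ) :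
    (P * gibbsWeight β H * X).trace =
      (P * gibbsWeight (β / 2) H * X * (P * gibbsWeight (β / 2) H)ᴴ).trace := by
  set V := gibbsWeight (β / 2) H with hV
  have hc : P * V = V * P := (commute_gibbsWeight_of_commute hPH (β / 2)).eq
  rw [conjTranspose_proj_mul_gibbsWeight hP hH hPH, ← hV, ← gibbsWeight_half_mul_half, ← hV]
  have key : P * V * (P * V) = P * (V * V) := by
    calc P * V * (P * V) = P * (V * P) * V := by simp only [Matrix.mul_assoc]
      _ = P * (P * V) * V := by rw [hc]
      _ = P * (V * V) := by rw [← Matrix.mul_assoc P P V, hPP, Matrix.mul_assoc]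
  calc (P * (V * V) * X).trace = (P * V * (P * V) * X).trace := by rw [key]
    _ = (P * V * (P * V * X)).trace := by rw [Matrix.mul_assoc (P * V) (P * V) X]
    _ = (P * V * X * (P * V)).trace := by rw [trace_mul_comm]

/-- **Positivity of projected Gibbs averages**: `tr(P e^{-βH} X) ≥ 0` (as an element of `ℂ`, i.e.
real and nonnegative) for `X ≥ 0`, `P` a Hermitian idempotent commuting with the Hermitian `H`.
Bratteli–Robinson II §5.3.1. [folklore] -/
theorem re_trace_proj_gibbsWeight_mul_nonneg {P H : Matrix n n ℂ} (hP : P.IsHermitian)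
    (hPP : P * P = P) (hH : H.IsHermitian) (hPH : Commute P H) (β : ℝ) {X : Matrix n n ℂ}
    (hX : X.PosSemidef) : 0 ≤ (P * gibbsWeight β H * X).trace := by
  rw [trace_proj_gibbsWeight_mul_eq hP hPP hH hPH β X]
  exact (hX.mul_mul_conjTranspose_same (P * gibbsWeight (β / 2) H)).trace_nonneg

/-- The projected partition function `tr(P e^{-βH})` is real and nonnegative. [folklore] -/
theorem trace_proj_gibbsWeight_nonneg {P H : Matrix n n ℂ} (hP : P.IsHermitian)
    (hPP : P * P = P) (hH : H.IsHermitian) (hPH : Commute P H) (β : ℝ) :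
    0 ≤ (P * gibbsWeight β H).trace := by
  have h := re_trace_proj_gibbsWeight_mul_nonneg hP hPP hH hPH β PosSemidef.one
  rwa [Matrix.mul_one] at h

/-- **The projected partition function of a nonzero sector is positive**: `tr(P e^{-βH}) > 0` for a
nonzero Hermitian idempotent `P` commuting with the Hermitian `H` (`tr((PV)(PV)ᴴ) = 0` forces
`PV = 0`, and `V = e^{-(β/2)H}` is invertible). Bratteli–Robinson II §5.3.1. [folklore] -/
theorem trace_proj_gibbsWeight_pos {P H : Matrix n n ℂ} (hP : P.IsHermitian) (hPP : P * P = P)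
    (hH : H.IsHermitian) (hPH : Commute P H) (β : ℝ) (hP0 : P ≠ 0) :
    0 < (P * gibbsWeight β H).trace := by
  have heq : (P * gibbsWeight β H).trace =
      (P * gibbsWeight (β / 2) H * (P * gibbsWeight (β / 2) H)ᴴ).trace := by
    have h := trace_proj_gibbsWeight_mul_eq hP hPP hH hPH β 1
    rwa [Matrix.mul_one, Matrix.mul_one] at h
  rw [heq]
  refine lt_of_le_of_ne (posSemidef_self_mul_conjTranspose _).trace_nonneg (fun h => hP0 ?_)
  have h0 : P * gibbsWeight (β / 2) H = 0 := trace_mul_conjTranspose_self_eq_zero_iff.mp h.symm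
  obtain ⟨u, hu⟩ : IsUnit (gibbsWeight (β / 2) H) := Matrix.isUnit_exp _
  calc P = P * ((↑u : Matrix n n ℂ) * ↑u⁻¹) := by rw [Units.mul_inv, Matrix.mul_one]
    _ = P * gibbsWeight (β / 2) H * ↑u⁻¹ := by rw [hu, Matrix.mul_assoc]
    _ = 0 := by rw [h0, Matrix.zero_mul]

end Abstract

/-! ### The half-filled sector of the XXZ torus -/

/-- `sectorProj M` is Hermitian. [bookkeeping] -/
theorem sectorProj_isHermitian (M : ℕ) [NeZero M] : (sectorProj M).IsHermitian := by
  rw [sectorProj_eq]; exact projMatrix_isHermitian _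

/-- `sectorProj M` is idempotent. [bookkeeping] -/
theorem sectorProj_mul_self (M : ℕ) [NeZero M] : sectorProj M * sectorProj M = sectorProj M := by
  rw [sectorProj_eq]; exact projMatrix_mul_self _

/-- `sectorProj M` commutes with `H_M(Δ)` for every real `Δ` (the sector `S^z_tot = 0` is invariant:
`[H_M(Δ), S^z_tot] = 0`). Tasaki (2020) §2.2. [folklore] -/
theorem sectorProj_commute_xxz (M : ℕ) [NeZero M] (Δ : ℝ) :
    Commute (sectorProj M) (xxzHamiltonian 1 (torusGraph 2 M) (-1) Δ) := by
  rw [sectorProj_eq]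
  exact projMatrix_map_commute_of_invariant (xxzHamiltonian_isHermitian 1 (torusGraph 2 M) (-1) Δ) _
    (fun v hv => XXZKT.mulVec_mem_spinZSector_of_commute
      (HardCoreBoson.commute_xxzHamiltonian_totalSpin_two 1 (torusGraph 2 M) (-1) Δ) hv)

/-- `S⁺_tot S⁻_tot = B Bᴴ` with `B = S⁺_tot` (`S⁻_x = (S⁺_x)ᴴ`). Kennedy–Lieb–Shastry (1988). [folklore] -/
theorem condensateOp_eq_mul_conjTranspose (M : ℕ) [NeZero M] :
    condensateOp M = (∑ x : TorusSite 2 M, onSite x (spinRaise 1)) *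
      (∑ x : TorusSite 2 M, onSite x (spinRaise 1))ᴴ := by
  rw [condensateOp_eq, Matrix.conjTranspose_sum]
  congr 1
  refine Finset.sum_congr rfl fun y _ => ?_
  rw [← onSite_conjTranspose, ← spinLower_eq_conjTranspose]

/-- The condensate operator `S⁺_tot S⁻_tot` is positive semidefinite. [folklore] -/
theorem condensateOp_posSemidef (M : ℕ) [NeZero M] : (condensateOp M).PosSemidef := by
  rw [condensateOp_eq_mul_conjTranspose]
  exact posSemidef_self_mul_conjTranspose _

/-- For even `M ≥ 2` the half-filled sector is not `⊥`, so `sectorProj M ≠ 0`. [bookkeeping] -/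
theorem sectorProj_ne_zero (M : ℕ) [NeZero M] (hE : Even M) (h2 : 2 ≤ M) : sectorProj M ≠ 0 := by
  obtain ⟨ψ, hmem, hψ1, -⟩ := exists_unit_sectorGroundState_xy M hE h2
  intro hP
  have h := projMatrix_map_mulVec_of_mem (spinZSector (Λ := TorusSite 2 M) 1 0) hmem
  rw [← sectorProj_eq, hP, Matrix.zero_mulVec] at h
  rw [← h, dotProduct_zero] at hψ1
  exact zero_ne_one hψ1

/-- **The sector partition function is positive**: `tr(P₀ e^{-βH_M(Δ)}) > 0` (real and positive) for
even `M ≥ 2` and every real `β`, `Δ`. Bratteli–Robinson II §5.3.1. [folklore] -/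
theorem sectorPartition_pos (M : ℕ) [NeZero M] (hE : Even M) (h2 : 2 ≤ M) (β Δ : ℝ) :
    0 < (sectorProj M * gibbsWeight β (xxzHamiltonian 1 (torusGraph 2 M) (-1) Δ)).trace :=
  trace_proj_gibbsWeight_pos (sectorProj_isHermitian M) (sectorProj_mul_self M)
    (xxzHamiltonian_isHermitian 1 _ (-1) Δ) (sectorProj_commute_xxz M Δ) β (sectorProj_ne_zero M hE h2)

/-- The numerator `tr(P₀ e^{-βH_M(Δ)} S⁺_tot S⁻_tot)` is real and nonnegative. [folklore] -/
theorem sectorCondensateTrace_nonneg (M : ℕ) [NeZero M] (β Δ : ℝ) :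
    0 ≤ (sectorProj M * gibbsWeight β (xxzHamiltonian 1 (torusGraph 2 M) (-1) Δ) *
      condensateOp M).trace :=
  re_trace_proj_gibbsWeight_mul_nonneg (sectorProj_isHermitian M) (sectorProj_mul_self M)
    (xxzHamiltonian_isHermitian 1 _ (-1) Δ) (sectorProj_commute_xxz M Δ) β (condensateOp_posSemidef M)

/-- **The canonical sector condensate is nonnegative**: `Λ_{β,M}(Δ) ≥ 0` for every `M`, `β`, `Δ`
(numerator `≥ 0`, denominator real `≥ 0`; the junk value `x/0 = 0` covers an empty sector).
[folklore] -/
theorem thermalCondensate_nonneg (M : ℕ) [NeZero M] (β Δ : ℝ) : 0 ≤ thermalCondensate M β Δ := by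
  rw [thermalCondensate_eq]
  obtain ⟨hn_re, hn_im⟩ := Complex.nonneg_iff.mp (sectorCondensateTrace_nonneg M β Δ)
  obtain ⟨hd_re, hd_im⟩ := Complex.nonneg_iff.mp
    (trace_proj_gibbsWeight_nonneg (sectorProj_isHermitian M) (sectorProj_mul_self M)
      (xxzHamiltonian_isHermitian 1 (torusGraph 2 M) (-1) Δ) (sectorProj_commute_xxz M Δ) β)
  rw [Complex.div_re, ← hn_im, zero_mul, zero_div, add_zero]
  exact div_nonneg (mul_nonneg hn_re hd_re) (Complex.normSq_nonneg _)

/-! ### The registered stub at the endpoints `Δ = -1`, `Δ = 0` and at `β = 0` -/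

/-- The thermal chord at `Δ = -1` reads `0 ≤ Λ_{β,M}(-1)`; it holds for every `β`. [bookkeeping] -/
theorem thermalChordAF_negOne (M : ℕ) [NeZero M] (β : ℝ) :
    (1 + (-1 : ℝ)) * thermalCondensate M β 0 ≤ thermalCondensate M β (-1) := by
  rw [add_neg_cancel, zero_mul]
  exact thermalCondensate_nonneg M β (-1)

/-- The thermal chord at `Δ = 0` is an identity. [bookkeeping] -/
theorem thermalChordAF_zero (M : ℕ) [NeZero M] (β : ℝ) :
    (1 + (0 : ℝ)) * thermalCondensate M β 0 ≤ thermalCondensate M β 0 := by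
  rw [add_zero, one_mul]

/-- **Registered stub `stub_thermalChordAF` at its ENDPOINTS** (ChordXY skeleton `c9438cf6…`): for
`Δ ∈ {-1, 0}` the inequality `(1+Δ)·Λ_{β,M}(0) ≤ Λ_{β,M}(Δ)` holds for every `β`, hence eventually.
(The hypotheses `Even M`, `4 ≤ M` of the registered signature are not used.) [bookkeeping] -/
theorem stub_thermalChordAF_endpoints :
    ∀ (M : ℕ) [NeZero M], Even M → 4 ≤ M → ∀ Δ ∈ ({-1, 0} : Set ℝ),
      ∀ᶠ β : ℝ in atTop, (1 + Δ) * thermalCondensate M β 0 ≤ thermalCondensate M β Δ := by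
  intro M _ _ _ Δ hΔ
  refine Eventually.of_forall fun β => ?_
  simp only [Set.mem_insert_iff, Set.mem_singleton_iff] at hΔ
  rcases hΔ with rfl | rfl
  · exact thermalChordAF_negOne M β
  · exact thermalChordAF_zero M β

/-- At infinite temperature the sector condensate does not depend on the anisotropy:
`Λ_{0,M}(Δ) = tr(P₀ S⁺_tot S⁻_tot)/tr P₀`. [bookkeeping] -/
theorem thermalCondensate_beta_zero (M : ℕ) [NeZero M] (Δ Δ' : ℝ) :
    thermalCondensate M 0 Δ = thermalCondensate M 0 Δ' := by
  rw [thermalCondensate_eq, thermalCondensate_eq, gibbsWeight_zero, gibbsWeight_zero]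

/-- **The thermal chord at `β = 0`**: `(1+Δ)·Λ_{0,M}(0) ≤ Λ_{0,M}(Δ)` for every `Δ ≤ 0` (both sides are
the same nonnegative number and `1 + Δ ≤ 1`). [bookkeeping] -/
theorem thermalChordAF_beta_zero (M : ℕ) [NeZero M] {Δ : ℝ} (hΔ : Δ ≤ 0) :
    (1 + Δ) * thermalCondensate M 0 0 ≤ thermalCondensate M 0 Δ := by
  rw [thermalCondensate_beta_zero M 0 Δ]
  have h0 := thermalCondensate_nonneg M 0 Δ
  nlinarith

/-! ### Converse transfer: a strict ground-state chord gives the thermal chord -/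

/-- **Strict ground-state chord ⇒ thermal chord, eventually in `β`.** If `ψ₀`, `ψ` are normalised
`S^z_tot = 0` sector ground states of `H_M(0)`, `H_M(Δ)` (even `M ≥ 2`, any real `Δ`) with the STRICT
chord `(1+Δ)·Re⟨ψ₀, S⁺S⁻ψ₀⟩ < Re⟨ψ, S⁺S⁻ψ⟩`, then `(1+Δ)·Λ_{β,M}(0) < Λ_{β,M}(Δ)` for all large `β`
(both sides converge, `stub_groundStateLimit`; `Tendsto.eventually_lt`). [folklore] -/
theorem eventually_thermalChord_lt_of_groundChord_lt (M : ℕ) [NeZero M] (hE : Even M) (h2 : 2 ≤ M)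
    (Δ : ℝ) (ψ₀ ψ : TensorIndex (TorusSite 2 M) 2 → ℂ)
    (hmem₀ : ψ₀ ∈ spinZSector (Λ := TorusSite 2 M) 1 0) (hψ₀1 : star ψ₀ ⬝ᵥ ψ₀ = 1)
    (heig₀ : Matrix.mulVec (xxzHamiltonian 1 (torusGraph 2 M) (-1) 0) ψ₀ =
      ((lowestEnergyInSector 1 (xxzHamiltonian 1 (torusGraph 2 M) (-1) 0) 0 : ℝ) : ℂ) • ψ₀)
    (hmem : ψ ∈ spinZSector (Λ := TorusSite 2 M) 1 0) (hψ1 : star ψ ⬝ᵥ ψ = 1)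
    (heig : Matrix.mulVec (xxzHamiltonian 1 (torusGraph 2 M) (-1) Δ) ψ =
      ((lowestEnergyInSector 1 (xxzHamiltonian 1 (torusGraph 2 M) (-1) Δ) 0 : ℝ) : ℂ) • ψ)
    (hlt : (1 + Δ) * (star ψ₀ ⬝ᵥ Matrix.mulVec ((∑ x : TorusSite 2 M, onSite x (spinRaise 1)) *
        (∑ y : TorusSite 2 M, onSite y (spinLower 1))) ψ₀).re <
      (star ψ ⬝ᵥ Matrix.mulVec ((∑ x : TorusSite 2 M, onSite x (spinRaise 1)) *
        (∑ y : TorusSite 2 M, onSite y (spinLower 1))) ψ).re) :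
    ∀ᶠ β : ℝ in atTop, (1 + Δ) * thermalCondensate M β 0 < thermalCondensate M β Δ :=
  ((stub_groundStateLimit M hE h2 0 ψ₀ hmem₀ hψ₀1 heig₀).const_mul (1 + Δ)).eventually_lt
    (stub_groundStateLimit M hE h2 Δ ψ hmem hψ1 heig) hlt

/-- **The registered stub at a fixed `M` from the STRICT ground-state chord on `(-1,0)`.** For even
`M ≥ 4`: if for every `Δ ∈ (-1,0)` and all normalised sector ground states `ψ₀` of `H_M(0)` and `ψ` of
`H_M(Δ)` the chord is strict, `(1+Δ)·Re⟨ψ₀,S⁺S⁻ψ₀⟩ < Re⟨ψ,S⁺S⁻ψ⟩`, then the conclusion of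
`stub_thermalChordAF` holds at `M` for every `Δ ∈ [-1,0]` (endpoints: `stub_thermalChordAF_endpoints`;
interior: `eventually_thermalChord_lt_of_groundChord_lt` with sector ground states, which exist by
`exists_unit_sectorGroundState_xy` / `XXZKT.exists_eigenvector_lowestEnergyInSector`). The thermal
detour of the skeleton is therefore equivalent to the crux away from non-strictness. [folklore] -/
theorem stub_thermalChordAF_of_strictGroundChord (M : ℕ) [NeZero M] (hE : Even M) (h4 : 4 ≤ M)
    (hstrict : ∀ Δ ∈ Set.Ioo (-1:ℝ) 0, ∀ (ψ₀ ψ : TensorIndex (TorusSite 2 M) 2 → ℂ),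
      ψ₀ ∈ spinZSector (Λ := TorusSite 2 M) 1 0 → star ψ₀ ⬝ᵥ ψ₀ = 1 →
      Matrix.mulVec (xxzHamiltonian 1 (torusGraph 2 M) (-1) 0) ψ₀ =
        ((lowestEnergyInSector 1 (xxzHamiltonian 1 (torusGraph 2 M) (-1) 0) 0 : ℝ) : ℂ) • ψ₀ →
      ψ ∈ spinZSector (Λ := TorusSite 2 M) 1 0 → star ψ ⬝ᵥ ψ = 1 →
      Matrix.mulVec (xxzHamiltonian 1 (torusGraph 2 M) (-1) Δ) ψ =
        ((lowestEnergyInSector 1 (xxzHamiltonian 1 (torusGraph 2 M) (-1) Δ) 0 : ℝ) : ℂ) • ψ →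
      (1 + Δ) * (star ψ₀ ⬝ᵥ Matrix.mulVec ((∑ x : TorusSite 2 M, onSite x (spinRaise 1)) *
          (∑ y : TorusSite 2 M, onSite y (spinLower 1))) ψ₀).re <
        (star ψ ⬝ᵥ Matrix.mulVec ((∑ x : TorusSite 2 M, onSite x (spinRaise 1)) *
          (∑ y : TorusSite 2 M, onSite y (spinLower 1))) ψ).re) :
    ∀ Δ ∈ Set.Icc (-1:ℝ) 0,
      ∀ᶠ β : ℝ in atTop, (1 + Δ) * thermalCondensate M β 0 ≤ thermalCondensate M β Δ := by
  intro Δ hΔ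
  have h2 : 2 ≤ M := le_trans (by norm_num) h4
  rcases eq_or_lt_of_le hΔ.1 with h | hlo
  · exact stub_thermalChordAF_endpoints M hE h4 Δ (Or.inl h.symm)
  rcases eq_or_lt_of_le hΔ.2 with h | hhi
  · exact stub_thermalChordAF_endpoints M hE h4 Δ (Or.inr h)
  -- interior: sector ground states exist at `0` and at `Δ`
  obtain ⟨ψ₀, hmem₀, hψ₀1, heig₀⟩ := exists_unit_sectorGroundState_xy M hE h2
  have hψ₀0 : ψ₀ ≠ 0 := by
    intro h
    rw [h, dotProduct_zero] at hψ₀1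
    exact zero_ne_one hψ₀1
  have hne : spinZSector (Λ := TorusSite 2 M) 1 0 ≠ ⊥ := by
    intro h
    rw [h, Submodule.mem_bot] at hmem₀
    exact hψ₀0 hmem₀
  obtain ⟨ψ, hmem, hψ1, heig⟩ := XXZKT.exists_eigenvector_lowestEnergyInSector
    (xxzHamiltonian_isHermitian 1 (torusGraph 2 M) (-1) Δ)
    (HardCoreBoson.commute_xxzHamiltonian_totalSpin_two 1 (torusGraph 2 M) (-1) Δ) hne
  exact (eventually_thermalChord_lt_of_groundChord_lt M hE h2 Δ ψ₀ ψ hmem₀ hψ₀1 heig₀ hmem hψ1 heig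
    (hstrict Δ ⟨hlo, hhi⟩ ψ₀ ψ hmem₀ hψ₀1 heig₀ hmem hψ1 heig)).mono fun β hβ => hβ.le

end Summit.HubbardSuperconductivity.HubbardSuperconductivity.Theorems.AnisotropyChord

end
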